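import Summits.BirchSwinnertonDyer.BirchSwinnertonDyer.Theorems.SignedLowerHalvesSmallImageLowerHalfBothSignsMuRiderMuDefect
import Summits.BirchSwinnertonDyer.BirchSwinnertonDyer.Theorems.SignedLowerHalvesSmallImageMuZeroOneSignMuControl
import HarnessLib

/-!
# Route `SignedLowerHalves` (K3), crux L `SmallImageLowerHalfBothSigns` (item stmt-BirchSwinnertonDyer-23599), line
# `birth_acns` v14, stub `stub_muBothSigns_ns`: THE SIGN-BLIND `μ`-DEFECT, part 2 — with the brick of line `birth_mu`
# (non-surjective image): second-sign analytic `μ` = algebraic `μ`; `p = 3`; the stub text ⟺ one-sign rider ∧ M∀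
# (cell `bsd-ssimc`, width seat `bsd-line-slh-p3-w2` gen 4; helper file `--supports 23599`; THEOREMS ONLY, route-independent)

Part 1 (`…MuRiderMuDefect.lean`, same namespace) proves the image-free sign-blind defect
`μ(ξ^ε) + μ(L_p^{ε'}) = μ(ξ^{ε'}) + μ(L_p^ε)` (and for `λ`) on Kobayashi's JOINT `±` package, and «second sign ⟺ equal
algebraic `μ`» given the floor sign.  Here:

* §2′ `mu_kobayashiL_eq_mu_of_not_surj` — at NON-surjective image the brick
  `SmallImageMuControl.mu_eq_zero_of_isSignedPAdicLFunction_of_hasUnitContent` (Kato primitivity + lane B's Euler-system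
  `μ`-transfer; `hCK` = the joint fact projected) gives `μ(ξ^{ε₀}) = 0` at the floor sign, hence `μ(L_p^{ε'}) = μ(ξ^{ε'})`:
  the second sign's ANALYTIC `μ` IS its ALGEBRAIC `μ`; `forall_hasUnitContent_iff_floor_and_forall_mu_eq_zero_of_not_surj`
  — both-signs rider at the pair ⟺ floor ∧ `∀ ε D ξ, μ(ξ) = 0`.
* §3 `p = 3` (floor input-free = THEOREM B, `LargeImageMuFloor.exists_sign_hasUnitContent_kobayashiL_three`):
  `forall_hasUnitContent_iff_mu_eq_three` (any image: both signs ⟺ `μ(ξ⁺) = μ(ξ⁻)`),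
  `forall_hasUnitContent_iff_forall_mu_eq_zero_three_of_not_surj` (non-surjective image: both signs ⟺ M∀ at the pair).
* §4 `muBothSigns_iff_oneSign_and_muAllSigns` — CLASS FORM BY TEXT: the registered stub `stub_muBothSigns_ns` VERBATIM ⟺
  (retired 23117 `SmallImageOneSignUnitContent`'s body, `p ≥ 5`) ∧ (child M's body with `∃ ε` strengthened to `∀ ε`),
  modulo `hCKJ h12 h5 h3 hmodP` — DOSSIER-23599-23600 (B2) has «M ⟺ 23117 modulo L ∧ print»; the `∀ε`-form needs NO L.

HONEST FRAMING: CONDITIONAL on the displayed published binders BY NAME (`hCKJ` = Kobayashi Thm. 6.2/6.3/7.3 + proof of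
7.4 with Kato 12.5/12.6 on ONE zeta line; `h12`; `h5`/`h3`; `hmodP`); nothing is discharged; the stub (`stub-misstated`,
gens 0/2/3), child L, child M, crux 4 and BSD are NOT proved by any of this.

References: [Kobayashi2003] Conjecture (p. 2), Thm. 1.2, Thm. 6.2–6.3 (p. 11), Thm. 7.3 i) (7.21), proof of Thm. 7.4
(p. 13); [Kato2004Asterisque] Thm. 12.5–12.6 (p. 222), §13.8; [Pollack2003] Conj. 6.3 (p. 548); [PollackWeston2011]
Thm. 4.1 (1), Rem. 4.2; [GreenbergVatsal2000] p. 2 (2), §3 Rem. 3.4; [Vaserstein1972SL2] Theorem.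
-/

-- D-0017: single-problem summit, the namespace repeats the problem name by design.
set_option linter.dupNamespace false
set_option autoImplicit false

noncomputable section

open scoped Classical MatrixGroups ModularForm

open CongruenceSubgroup WeierstrassCurve Field
  Literature.NumberTheory.EllipticCurves Literature.NumberTheory.EllipticCurves.ModularForms
  Literature.NumberTheory.GaloisRepresentations Literature.NumberTheory.EllipticCurves.Rank1Residual
  Literature.NumberTheory.EllipticCurves.Kobayashi2003 Literature.NumberTheory.EllipticCurves.GreenbergVatsal2000
  ZpExtension
  Summit.BirchSwinnertonDyer.Rank1Residual.Supersingular Summit.BirchSwinnertonDyer.Rank1Residual.X1.MuLambda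
  Summit.BirchSwinnertonDyer.Rank1Residual.X11a

namespace Summit.BirchSwinnertonDyer.BirchSwinnertonDyer.Theorems.SmallImageLowerHalfBothSignsMuRiderMuDefect

open Summit.BirchSwinnertonDyer.BirchSwinnertonDyer.Theorems.SmallImageMuControl
  (mu_eq_zero_of_isSignedPAdicLFunction_of_hasUnitContent)

section SecondSignBrick

variable (W : WeierstrassCurve ℚ) [W.IsElliptic] [W.IsGloballyMinimal] (p : ℕ) [Fact p.Prime]

/-! ### §2′ With the brick of line `birth_mu` (non-surjective image): analytic `μ` = algebraic `μ` at the second sign -/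

/-- **At NON-surjective image, given the floor sign `ε₀`: `μ(L_p^{ε'}) = μ(ξ^{ε'})`** — the second sign's analytic
`μ`-invariant IS the algebraic one (the brick gives `μ(ξ^{ε₀}) = 0`).  GRANTED `hCKJ h12 h5 h3`.
[cite: Kobayashi2003, Thm. 1.2, Thm. 6.2–6.3, Thm. 7.3 (7.21), proof of Thm. 7.4] [cite: Kato2004Asterisque, Thm. 12.6, §13.8] -/
theorem mu_kobayashiL_eq_mu_of_not_surj
    (hCKJ : thm62_63_73_signedColemanKato_zetaJoint) (h12 : thm12_signedSelmerDual_finite_torsion)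
    (h5 : realPeriodRat_eq_unit_mul_plusPeriod) (h3 : realPeriodRat_eq_unit_mul_plusPeriod_three)
    (hp2 : p ≠ 2) (hgood : W.HasGoodReductionAtPrime p) (hap : W.frobeniusTrace p = 0)
    (hns : ¬ W.HasSurjectiveModNGaloisRep p)
    {κ : ZpExtension ℚ p} {γ : absoluteGaloisGroup ℚ} (hκ : κ.IsCyclotomic) (hγ : κ.IsTopGenerator γ)
    (hγc : IsCyclotomicVariable p γ)
    {N : ℕ} [NeZero N] {f : CuspForm (Gamma0 N) 2} (hf : IsNewformOf W f)
    {Lplus Lminus : IwasawaAlgebra p} (hL : IsPollackPair f p Lplus Lminus)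
    {ε₀ ε' : ℤˣ} (hfloor : HasUnitContent (kobayashiL ε₀ Lplus Lminus))
    (D₀ : SignedSelmerDualData W κ γ ε₀) (D' : SignedSelmerDualData W κ γ ε')
    {ξ₀ ξ' : IwasawaAlgebra p} (hξ₀ : D₀.charIdeal = Ideal.span {ξ₀}) (hξ' : D'.charIdeal = Ideal.span {ξ'}) :
    mu ξ₀ = 0 ∧ mu (kobayashiL ε' Lplus Lminus) = mu ξ' := by
  have hμ₀ : mu ξ₀ = 0 :=
    mu_eq_zero_of_isSignedPAdicLFunction_of_hasUnitContent W p (thm62_63_73_signedColemanKato_zeta_of_joint hCKJ)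
      h12 h5 h3 hp2 hgood hap hns f hf (hL.isSignedPAdicLFunction_kobayashiL ε₀) hfloor κ γ hκ hγ hγc D₀ hξ₀
  obtain ⟨-, hμ⟩ :=
    mu_kobayashiL_eq_mu_sub_mu W p hCKJ h12 h5 h3 hp2 hgood hap hκ hγ hγc hf hL hfloor D₀ D' hξ₀ hξ'
  refine ⟨hμ₀, ?_⟩
  rw [hμ, hμ₀, Nat.sub_zero]

/-- **At NON-surjective image: both-signs rider at the pair ⟺ floor ∧ every signed Selmer group has `μ = 0`**
(M's body with `∀ ε` at that pair, for every dual datum of the frame).  GRANTED `hCKJ h12 h5 h3`.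
[cite: Pollack2003, Conj. 6.3 (p. 548)] [cite: Kobayashi2003, Conjecture (p. 2), proof of Thm. 7.4 (p. 13)] -/
theorem forall_hasUnitContent_iff_floor_and_forall_mu_eq_zero_of_not_surj
    (hCKJ : thm62_63_73_signedColemanKato_zetaJoint) (h12 : thm12_signedSelmerDual_finite_torsion)
    (h5 : realPeriodRat_eq_unit_mul_plusPeriod) (h3 : realPeriodRat_eq_unit_mul_plusPeriod_three)
    (hp2 : p ≠ 2) (hgood : W.HasGoodReductionAtPrime p) (hap : W.frobeniusTrace p = 0)
    (hns : ¬ W.HasSurjectiveModNGaloisRep p)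
    {κ : ZpExtension ℚ p} {γ : absoluteGaloisGroup ℚ} (hκ : κ.IsCyclotomic) (hγ : κ.IsTopGenerator γ)
    (hγc : IsCyclotomicVariable p γ)
    {N : ℕ} [NeZero N] {f : CuspForm (Gamma0 N) 2} (hf : IsNewformOf W f)
    {Lplus Lminus : IwasawaAlgebra p} (hL : IsPollackPair f p Lplus Lminus) :
    (∀ ε : ℤˣ, HasUnitContent (kobayashiL ε Lplus Lminus)) ↔
      (∃ ε₀ : ℤˣ, HasUnitContent (kobayashiL ε₀ Lplus Lminus)) ∧
        ∀ (ε : ℤˣ) (D : SignedSelmerDualData W κ γ ε) (ξ : IwasawaAlgebra p),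
          D.charIdeal = Ideal.span {ξ} → mu ξ = 0 := by
  constructor
  · intro h
    refine ⟨⟨1, h 1⟩, fun ε D ξ hξ ↦ ?_⟩
    exact mu_eq_zero_of_isSignedPAdicLFunction_of_hasUnitContent W p
      (thm62_63_73_signedColemanKato_zeta_of_joint hCKJ) h12 h5 h3 hp2 hgood hap hns f hf
      (hL.isSignedPAdicLFunction_kobayashiL ε) (h ε) κ γ hκ hγ hγc D hξ
  · rintro ⟨⟨ε₀, h₀⟩, hall⟩ ε
    obtain ⟨D₀⟩ := nonempty_signedSelmerDualData W κ ε₀ hγ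
    obtain ⟨D⟩ := nonempty_signedSelmerDualData W κ ε hγ
    obtain ⟨ξ₀, hξ₀⟩ := (charIdeal_isPrincipal_holds p D₀.X).principal
    obtain ⟨ξ, hξ⟩ := (charIdeal_isPrincipal_holds p D.X).principal
    have hLne : kobayashiL ε Lplus Lminus ≠ 0 := by
      unfold kobayashiL
      split_ifs
      · exact hL.2.1
      · exact hL.1
    obtain ⟨-, hμ⟩ :=
      mu_kobayashiL_eq_mu_of_not_surj W p hCKJ h12 h5 h3 hp2 hgood hap hns hκ hγ hγc hf hL h₀ D₀ D hξ₀ hξ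
    exact hasUnitContent_of_mu_eq_zero hLne (by rw [hμ, hall ε D ξ hξ])

end SecondSignBrick

/-! ## §3 `p = 3`: the floor is input-free, so the rider's `p = 3` slice ⟺ M∀ at the pair; class form by name -/

section Three

variable (W : WeierstrassCurve ℚ) [W.IsElliptic] [W.IsGloballyMinimal] (p : ℕ) [Fact p.Prime]

/-- **`p = 3`, any image: both signs at the pair ⟺ `μ(ξ⁺) = μ(ξ⁻)`** — the floor sign is THEOREM B
(`LargeImageMuFloor.exists_sign_hasUnitContent_kobayashiL_three`, input-free), so at `a₃ = 0` Pollack's both-signs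
conjecture IS «the two signed Selmer groups over `ℚ_∞` have equal `μ`»; GRANTED `hCKJ h12 h5 h3` (conductor-level `f`).
[cite: Pollack2003, Conj. 6.3 (p. 548)] [cite: PollackWeston2011, Thm. 4.1 (1)] [cite: Vaserstein1972SL2, Theorem] -/
theorem forall_hasUnitContent_iff_mu_eq_three (hp3 : p = 3)
    (hCKJ : thm62_63_73_signedColemanKato_zetaJoint) (h12 : thm12_signedSelmerDual_finite_torsion)
    (h5 : realPeriodRat_eq_unit_mul_plusPeriod) (h3 : realPeriodRat_eq_unit_mul_plusPeriod_three)
    (hgood : W.HasGoodReductionAtPrime p) (hap : W.frobeniusTrace p = 0)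
    {κ : ZpExtension ℚ p} {γ : absoluteGaloisGroup ℚ} (hκ : κ.IsCyclotomic) (hγ : κ.IsTopGenerator γ)
    (hγc : IsCyclotomicVariable p γ)
    [NeZero (W.conductorNorm ℤ)] {f : CuspForm (Gamma0 (W.conductorNorm ℤ)) 2} (hf : IsNewformOf W f)
    {Lplus Lminus : IwasawaAlgebra p} (hL : IsPollackPair f p Lplus Lminus)
    (Dp : SignedSelmerDualData W κ γ 1) (Dm : SignedSelmerDualData W κ γ (-1))
    {ξp ξm : IwasawaAlgebra p} (hξp : Dp.charIdeal = Ideal.span {ξp}) (hξm : Dm.charIdeal = Ideal.span {ξm}) :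
    (∀ ε : ℤˣ, HasUnitContent (kobayashiL ε Lplus Lminus)) ↔ mu ξp = mu ξm := by
  have hp2 : p ≠ 2 := by omega
  have hfloor : ∃ ε₀ : ℤˣ, HasUnitContent (kobayashiL ε₀ Lplus Lminus) := by
    subst hp3
    obtain ⟨ε₀, h₀⟩ := LargeImageMuFloor.exists_sign_hasUnitContent_kobayashiL_three (W := W) f hf hgood hap
    exact ⟨ε₀, h₀ Lplus Lminus hL⟩
  rw [forall_hasUnitContent_iff_floor_and_mu_eq W p hCKJ h12 h5 h3 hp2 hgood hap hκ hγ hγc hf hL Dp Dm hξp hξm]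
  exact ⟨fun h ↦ h.2, fun h ↦ ⟨hfloor, h⟩⟩

/-- **`p = 3`, NON-surjective image: both signs at the pair ⟺ every signed Selmer group of the frame has `μ = 0`**
(M's body with `∀ ε`, at that pair).  GRANTED `hCKJ h12 h5 h3` (conductor-level `f`).
[cite: Pollack2003, Conj. 6.3 (p. 548)] [cite: Kobayashi2003, Conjecture (p. 2)] -/
theorem forall_hasUnitContent_iff_forall_mu_eq_zero_three_of_not_surj (hp3 : p = 3)
    (hCKJ : thm62_63_73_signedColemanKato_zetaJoint) (h12 : thm12_signedSelmerDual_finite_torsion)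
    (h5 : realPeriodRat_eq_unit_mul_plusPeriod) (h3 : realPeriodRat_eq_unit_mul_plusPeriod_three)
    (hgood : W.HasGoodReductionAtPrime p) (hap : W.frobeniusTrace p = 0) (hns : ¬ W.HasSurjectiveModNGaloisRep p)
    {κ : ZpExtension ℚ p} {γ : absoluteGaloisGroup ℚ} (hκ : κ.IsCyclotomic) (hγ : κ.IsTopGenerator γ)
    (hγc : IsCyclotomicVariable p γ)
    [NeZero (W.conductorNorm ℤ)] {f : CuspForm (Gamma0 (W.conductorNorm ℤ)) 2} (hf : IsNewformOf W f)
    {Lplus Lminus : IwasawaAlgebra p} (hL : IsPollackPair f p Lplus Lminus) :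
    (∀ ε : ℤˣ, HasUnitContent (kobayashiL ε Lplus Lminus)) ↔
      ∀ (ε : ℤˣ) (D : SignedSelmerDualData W κ γ ε) (ξ : IwasawaAlgebra p),
        D.charIdeal = Ideal.span {ξ} → mu ξ = 0 := by
  have hp2 : p ≠ 2 := by omega
  have hfloor : ∃ ε₀ : ℤˣ, HasUnitContent (kobayashiL ε₀ Lplus Lminus) := by
    subst hp3
    obtain ⟨ε₀, h₀⟩ := LargeImageMuFloor.exists_sign_hasUnitContent_kobayashiL_three (W := W) f hf hgood hap
    exact ⟨ε₀, h₀ Lplus Lminus hL⟩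
  rw [forall_hasUnitContent_iff_floor_and_forall_mu_eq_zero_of_not_surj W p hCKJ h12 h5 h3 hp2 hgood hap hns hκ hγ
    hγc hf hL]
  exact ⟨fun h ↦ h.2, fun h ↦ ⟨hfloor, h⟩⟩

end Three

/-! ## §4 Class form by name: the registered stub text ⟺ one-sign rider (p ≥ 5) ∧ M∀, modulo print — NO child L -/

section ClassForm

/-- **THE REGISTERED STUB `stub_muBothSigns_ns` (line `birth_acns` v14, text VERBATIM as the left-hand side) ⟺
(the ONE-sign rider at `p ≥ 5` = retired item 23117 `SmallImageOneSignUnitContent`'s body VERBATIM) ∧ (child M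
`SmallImageMuZeroOneSign`'s body with `∃ ε` STRENGTHENED to `∀ ε`), modulo print** (`hCKJ h12 h5 h3 hmodP`; `hmodP` only to
know the conductor-level newform exists).  (→): the rider trivially gives one sign; the brick gives `μ(ξ^ε) = 0` at each
sign.  (←): at `p = 3` the floor is THEOREM B (input-free), at `p ≥ 5` it is the displayed one-sign rider; then §2′
(`μ(L_p^{ε'}) = μ(ξ^{ε'}) = 0`).  Compare DOSSIER-23599-23600 (B2) «M ⟺ 23117 modulo L ∧ print»: the `∀ε`-form of M
needs NO lower half.  CONDITIONAL; nothing is discharged; the stub, L, M stay OPEN.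
[cite: Pollack2003, Conj. 6.3 (p. 548)] [cite: Kobayashi2003, Conjecture (p. 2), Thm. 1.2, Thm. 6.2–6.3, 7.3, proof of 7.4]
[cite: Kato2004Asterisque, Thm. 12.5–12.6] [cite: PollackWeston2011, Thm. 4.1 (1), Rem. 4.2] -/
theorem muBothSigns_iff_oneSign_and_muAllSigns
    (hCKJ : thm62_63_73_signedColemanKato_zetaJoint) (h12 : thm12_signedSelmerDual_finite_torsion)
    (h5 : realPeriodRat_eq_unit_mul_plusPeriod) (h3 : realPeriodRat_eq_unit_mul_plusPeriod_three)
    (hmodP : nonempty_modularParametrizationData) :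
    (∀ (W : WeierstrassCurve ℚ) [W.IsElliptic] [W.IsGloballyMinimal] (p : ℕ) [Fact p.Prime],
      p ≠ 2 → ClassX7 W p → ¬ W.HasCM → W.frobeniusTrace p = 0 → ¬ Surj W p →
      ∀ [NeZero (W.conductorNorm ℤ)] (f : CuspForm (Gamma0 (W.conductorNorm ℤ)) 2),
      IsNewformOf W f → ∀ ε : ℤˣ, ∃ L₀ : IwasawaAlgebra p,
        IsSignedPAdicLFunction f p ε L₀ ∧ HasUnitContent L₀) ↔
    ((∀ (W : WeierstrassCurve ℚ) [W.IsElliptic] [W.IsGloballyMinimal] (p : ℕ) [Fact p.Prime], 5 ≤ p →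
      ClassX7 W p → ¬ W.HasCM → W.frobeniusTrace p = 0 → ¬ Surj W p →
      ∀ [NeZero (W.conductorNorm ℤ)] (f : CuspForm (Gamma0 (W.conductorNorm ℤ)) 2),
      IsNewformOf W f → ∃ (ε₀ : ℤˣ) (L₀ : IwasawaAlgebra p), IsSignedPAdicLFunction f p ε₀ L₀ ∧ HasUnitContent L₀) ∧
    (∀ (W : WeierstrassCurve ℚ) [W.IsElliptic] [W.IsGloballyMinimal] (p : ℕ) [Fact p.Prime],
      p ≠ 2 → ClassX7 W p → ¬ W.HasCM → W.frobeniusTrace p = 0 → ¬ Surj W p →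
      ∀ (ε : ℤˣ) (κ : ZpExtension ℚ p) (γ : absoluteGaloisGroup ℚ), κ.IsCyclotomic → κ.IsTopGenerator γ →
        IsCyclotomicVariable p γ → ∀ (D : SignedSelmerDualData W κ γ ε) (ξ : IwasawaAlgebra p),
          D.charIdeal = Ideal.span {ξ} → mu ξ = 0)) := by
  have hCK : thm62_63_73_signedColemanKato_zeta := thm62_63_73_signedColemanKato_zeta_of_joint hCKJ
  constructor
  · intro h
    refine ⟨fun W _ _ p _ hp5 hX hCM hap hs _ f hf ↦ ?_, fun W _ _ p _ hp2 hX hCM hap hs ε κ γ hκ hγ hγc D ξ hξ ↦ ?_⟩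
    · obtain ⟨L₀, hL₀⟩ := h W p (by omega) hX hCM hap hs f hf 1
      exact ⟨1, L₀, hL₀⟩
    · haveI : NeZero (W.conductorNorm ℤ) := ⟨(W.conductorNorm_pos_holds).ne'⟩
      obtain ⟨f, hf⟩ := exists_isNewformOf_of_nonempty_modularParametrizationData hmodP W
      obtain ⟨L₀, hL₀, hu₀⟩ := h W p hp2 hX hCM hap hs f hf ε
      exact mu_eq_zero_of_isSignedPAdicLFunction_of_hasUnitContent W p hCK h12 h5 h3 hp2 hX.1.1 hap hs f hf hL₀ hu₀
        κ γ hκ hγ hγc D hξ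
  · rintro ⟨hone, hall⟩ W _ _ p _ hp2 hX hCM hap hs _ f hf
    have hgood : W.HasGoodReductionAtPrime p := hX.1.1
    obtain ⟨Lplus, Lminus, hL⟩ :=
      exists_isPollackPair pollack_exists_plusMinusPAdicLFunction_holds hp2 hf hgood hap
    -- the cyclotomic frame
    obtain ⟨κ, hκ, γ, hγ, hγc⟩ := exists_isCyclotomic_isTopGenerator_isCyclotomicVariable_holds p
    -- the floor sign: THEOREM B at `p = 3`, the displayed one-sign rider at `p ≥ 5`
    have hfloor : ∃ ε₀ : ℤˣ, HasUnitContent (kobayashiL ε₀ Lplus Lminus) := by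
      by_cases hp5 : 5 ≤ p
      · obtain ⟨ε₀, L₀, hL₀, hu₀⟩ := hone W p hp5 hX hCM hap hs f hf
        exact ⟨ε₀, LargeImageMuFloor.hasUnitContent_kobayashiL_of_isSignedPAdicLFunction hL hL₀ hu₀⟩
      · have h2 := (Fact.out : p.Prime).two_le
        have hp3 : p = 3 := by
          interval_cases p
          · exact absurd rfl hp2
          · rfl
          · exact absurd (Fact.out : Nat.Prime 4) (by decide)
        subst hp3
        obtain ⟨ε₀, h₀⟩ := LargeImageMuFloor.exists_sign_hasUnitContent_kobayashiL_three (W := W) f hf hgood hap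
        exact ⟨ε₀, h₀ Lplus Lminus hL⟩
    have hboth := (forall_hasUnitContent_iff_floor_and_forall_mu_eq_zero_of_not_surj W p hCKJ h12 h5 h3 hp2 hgood
      hap hs hκ hγ hγc hf hL).mpr ⟨hfloor, fun ε D ξ hξ ↦ hall W p hp2 hX hCM hap hs ε κ γ hκ hγ hγc D ξ hξ⟩
    intro ε
    exact ⟨kobayashiL ε Lplus Lminus, hL.isSignedPAdicLFunction_kobayashiL ε, hboth ε⟩

end ClassForm

end Summit.BirchSwinnertonDyer.BirchSwinnertonDyer.Theorems.SmallImageLowerHalfBothSignsMuRiderMuDefect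

end
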